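import Literature.AlgebraicGeometry.Motives.HirschowitzIyerCovering
import Mathlib.FieldTheory.IsAlgClosed.AlgebraicClosure
import Mathlib.FieldTheory.IntermediateField.Adjoin.Basic
import HarnessLib

/-!
# A strong line through a point of `V(Q, C)` with values in any field (Hirschowitz–Iyer Lemma 2.2, `s = 0`: the generic strong line)

For the proof of Hirschowitz–Iyer 2010, Lemma 2.2 with `s = 0 < r = 1` ("choosing carefully an
algebraic family `(H_z ⊂ H'_z)_{z ∈ Z}` of strong `s`-planes covering `W`") one needs a strong line
of the pair `V(Q, C) ⊂ V(Q)` through the GENERIC point of the curve `W`, i.e. through a point with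
coordinates in the function field `F = K(W)`, defined over a finite extension `F'` of `F` (the
function field of the parameter curve `Z`). This file produces it from the coordinate covering
theorem `StrongLineCover.exists_fatFlag_of_forms` applied over an algebraic closure of `F`:

* `StrongLineCover.exists_fatFlag_over_finite_extension` — for forms `Q, C` over a field `K` of
  characteristic zero, a field `F ⊇ K` and a non-zero `p ∈ F⁹`
  with `Q(p) = C(p) = 0`, there are a finite extension `F' ⊆ F̄` of `F` and linearly independent
  `u, v, w ∈ F'⁹` with `p = α u + β v` (`α, β ∈ F'`), `Q ≡ 0` on `span(u, v, w)` and
  `C(c₀u + c₁v + c₂w) = c₂³ C(w)` (a fat flag over `F'`).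

## References

* A. Hirschowitz, J. N. N. Iyer, Contemp. Math. 522 (2010), arXiv:0903.5018, §2 Lemma 2.2 (proof,
  case `s < r`). [HirschowitzIyer2010]
-/

noncomputable section

open MvPolynomial

namespace Literature.AlgebraicGeometry.Motives

namespace StrongLineCover

variable {K : Type*} [Field K] [CharZero K] {F : Type*} [Field F] [Algebra K F]

/-- Evaluation commutes with extension of scalars: `Q^φ(φ ∘ p) = φ(Q(p))`. [folklore] -/
theorem eval_map_comp {R S : Type*} [CommRing R] [CommRing S] (φ : R →+* S) (p : Fin 9 → R)
    (Q : MvPolynomial (Fin 9) R) : MvPolynomial.eval (φ ∘ p) (MvPolynomial.map φ Q) = φ (MvPolynomial.eval p Q) := by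
  simp only [MvPolynomial.eval_map]
  induction Q using MvPolynomial.induction_on with
  | C a => simp
  | add q q' hq hq' => simp only [eval₂_add, map_add, hq, hq']
  | mul_X q i hq => simp only [eval₂_mul, eval₂_X, map_mul, hq, Function.comp_apply, eval_X]

/-- **A strong line through an `F`-valued point of `V(Q, C)`, over a finite extension of `F`**
(the generic strong line of Hirschowitz–Iyer's Lemma 2.2, `s = 0`): see the module docstring.
[cite: HirschowitzIyer2010, §2 Lemma 2.2 (proof, the family of strong s-planes)] -/
theorem exists_fatFlag_over_finite_extension {Q C : MvPolynomial (Fin 9) K} (hQ : Q.IsHomogeneous 2)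
    (hC : C.IsHomogeneous 3) {p : Fin 9 → F} (hp : p ≠ 0)
    (hQp : MvPolynomial.eval p (MvPolynomial.map (algebraMap K F) Q) = 0)
    (hCp : MvPolynomial.eval p (MvPolynomial.map (algebraMap K F) C) = 0) :
    ∃ (F' : IntermediateField F (AlgebraicClosure F)), FiniteDimensional F F' ∧
      ∃ (u v w : Fin 9 → F') (α β : F'), LinearIndependent F' ![u, v, w] ∧
        (algebraMap F F' ∘ p) = α • u + β • v ∧
        (∀ c : Fin 3 → F', MvPolynomial.eval (comb u v w c)
          (MvPolynomial.map ((algebraMap F F').comp (algebraMap K F)) Q) = 0) ∧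
        ∀ c : Fin 3 → F', MvPolynomial.eval (comb u v w c)
            (MvPolynomial.map ((algebraMap F F').comp (algebraMap K F)) C) =
          c 2 ^ 3 * MvPolynomial.eval w (MvPolynomial.map ((algebraMap F F').comp (algebraMap K F)) C) := by
  classical
  set Fb := AlgebraicClosure F with hFb
  haveI : CharZero F := charZero_of_injective_algebraMap (algebraMap K F).injective
  haveI : CharZero Fb := charZero_of_injective_algebraMap (algebraMap F Fb).injective
  -- the data over `F̄`
  set φ : K →+* Fb := algebraMap K Fb with hφ
  have hφ' : φ = (algebraMap F Fb).comp (algebraMap K F) := IsScalarTower.algebraMap_eq K F Fb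
  set pb : Fin 9 → Fb := algebraMap F Fb ∘ p with hpb
  have hpb0 : pb ≠ 0 := by
    obtain ⟨i, hi⟩ := Function.ne_iff.mp hp
    refine Function.ne_iff.mpr ⟨i, ?_⟩
    simpa [hpb] using hi
  have hQb : (MvPolynomial.map φ Q).IsHomogeneous 2 := hQ.map φ
  have hCb : (MvPolynomial.map φ C).IsHomogeneous 3 := hC.map φ
  have hQpb : MvPolynomial.eval pb (MvPolynomial.map φ Q) = 0 := by
    rw [hφ', ← MvPolynomial.map_map, hpb, eval_map_comp, hQp, map_zero]
  have hCpb : MvPolynomial.eval pb (MvPolynomial.map φ C) = 0 := by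
    rw [hφ', ← MvPolynomial.map_map, hpb, eval_map_comp, hCp, map_zero]
  obtain ⟨ub, vb, wb, hli, hspan, hQvan, hCfat⟩ := exists_fatFlag_of_forms hQb hCb hpb0 hQpb hCpb
  obtain ⟨αb, βb, hαβ⟩ := Submodule.mem_span_pair.1 hspan
  -- the finite extension generated by all coordinates and `α, β`
  set S : Set Fb := Set.range ub ∪ Set.range vb ∪ Set.range wb ∪ {αb, βb} with hS
  haveI : Finite S := by
    have hfin : S.Finite := (((Set.finite_range ub).union (Set.finite_range vb)).union
      (Set.finite_range wb)).union (Set.toFinite _)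
    exact hfin.to_subtype
  set F' : IntermediateField F Fb := IntermediateField.adjoin F S with hF'
  have hFD : FiniteDimensional F F' :=
    IntermediateField.finiteDimensional_adjoin fun x _ => (Algebra.IsAlgebraic.isAlgebraic (R := F) x).isIntegral
  have hmem : ∀ x ∈ S, x ∈ F' := fun x hx => IntermediateField.subset_adjoin F S hx
  have hu : ∀ i, ub i ∈ F' := fun i => hmem _ (by simp [hS])
  have hv : ∀ i, vb i ∈ F' := fun i => hmem _ (by simp [hS])
  have hw : ∀ i, wb i ∈ F' := fun i => hmem _ (by simp [hS])
  have hα : αb ∈ F' := hmem _ (by simp [hS])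
  have hβ : βb ∈ F' := hmem _ (by simp [hS])
  set u : Fin 9 → F' := fun i => ⟨ub i, hu i⟩ with huF
  set v : Fin 9 → F' := fun i => ⟨vb i, hv i⟩ with hvF
  set w : Fin 9 → F' := fun i => ⟨wb i, hw i⟩ with hwF
  -- the inclusion `F' → F̄` and transfers
  set ι' : F' →+* Fb := (algebraMap F' Fb) with hι'
  have hιinj : Function.Injective ι' := (algebraMap F' Fb).injective
  have hιu : ι' ∘ u = ub := funext fun i => rfl
  have hιv : ι' ∘ v = vb := funext fun i => rfl
  have hιw : ι' ∘ w = wb := funext fun i => rfl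
  set ψ : K →+* F' := (algebraMap F F').comp (algebraMap K F) with hψ
  have hmapK : (MvPolynomial.map ι' (MvPolynomial.map ψ Q)) = MvPolynomial.map φ Q ∧
      (MvPolynomial.map ι' (MvPolynomial.map ψ C)) = MvPolynomial.map φ C := by
    have hcompK : ι'.comp ψ = φ := by
      rw [hψ, ← RingHom.comp_assoc, hφ']
      rfl
    constructor <;> rw [MvPolynomial.map_map, hcompK]
  refine ⟨F', hFD, u, v, w, ⟨αb, hα⟩, ⟨βb, hβ⟩, ?_, ?_, ?_, ?_⟩
  · -- linear independence descends along the injection `F'⁹ → F̄⁹`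
    rw [Fintype.linearIndependent_iff]
    intro g hg i
    have hg' : ∑ j, (ι' (g j)) • (![ub, vb, wb] : Fin 3 → Fin 9 → Fb) j = 0 := by
      have h := congrArg (fun q : Fin 9 → F' => ι' ∘ q) hg
      simp only [Function.comp_def, Pi.zero_apply, map_zero] at h
      funext m
      have hm := congrFun h m
      simp only [Finset.sum_apply, Pi.smul_apply, smul_eq_mul, Fin.sum_univ_three,
        Matrix.cons_val_zero, Matrix.cons_val_one, Matrix.cons_val] at hm ⊢
      exact hm
    have := (Fintype.linearIndependent_iff.1 hli) (fun j => ι' (g j)) hg' i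
    exact hιinj (by rw [this, map_zero])
  · funext i
    apply hιinj
    have h := congrFun hαβ i
    simp only [Pi.add_apply, Pi.smul_apply, smul_eq_mul] at h ⊢
    change algebraMap F' Fb (algebraMap F F' (p i)) = ι' (_)
    rw [← IsScalarTower.algebraMap_apply, map_add, map_mul, map_mul]
    exact h.symm
  · intro c
    apply hιinj
    rw [map_zero, ← eval_map_comp, hmapK.1, Function.comp_def]
    have hcomb : (fun x => ι' (comb u v w c x)) = comb ub vb wb (ι' ∘ c) := by
      funext x; rw [map_comb, hιu, hιv, hιw]
    rw [hcomb]
    exact hQvan _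
  · intro c
    apply hιinj
    rw [map_mul, map_pow, ← eval_map_comp, ← eval_map_comp, hmapK.2, Function.comp_def, hιw]
    have hcomb : (fun x => ι' (comb u v w c x)) = comb ub vb wb (ι' ∘ c) := by
      funext x; rw [map_comb, hιu, hιv, hιw]
    rw [hcomb, hCfat]
    rfl

end StrongLineCover

end Literature.AlgebraicGeometry.Motives

end
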